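/-
Origin: expansion seat `planner-pub-hodgecm-pv12-g3-0`, handover #2 2026-08-18T05:18:52Z (`HOME/pub-hodgecm-pv12-g3/lean/Pv12g3/ArchCFockAnalyticSmoke.lean`, md5 8664c061, 467 lines);
landed by the gen-6 packager in gate run 22 as `HodgeCM/PerL34/ArchCFockAnalyticSmoke.lean` (import ^import Pv[0-9]+g[0-9]+\.→import HodgeCM.PerL34. ×1).
-/
/-
Origin: HOME/pub-hodgecm-pv12-g3/lean/Pv12g3/ArchCFockAnalyticSmoke.lean — session planner-pub-hodgecm-pv12-g3-0 (unit
pub-hodgecm-pv12-g3, DAG-node prover #12 gen 3), non-vacuity guard for seam S4's final typed form `ArchCFockAnalytic.lean`.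
Intended final place: `HodgeCM/PerL34/ArchCFockAnalyticSmoke.lean`, namespace `HodgeCM.PerL34.ArchC.AnalyticSmoke`.
ONE WIP import to rewrite at intake: `import Pv12g3.ArchCFockAnalytic` → `import HodgeCM.PerL34.ArchCFockAnalytic`
(lands AFTER it).  Nothing imports this file.  Asserts nothing: no axiom, no placeholder proof; standard axiom trio.
-/
import Summits.HodgeConjecture.HodgeCM.PerL34.ArchCFockAnalytic_2

set_option autoImplicit false

/-!
# Seam S4 smoke: the record `FockAnalyticBridge` is inhabited over a genuinely linear theta toy

PURPOSE (referee A's standing vacuity question, asked of every hypothesis record).  `ArchC.FockAnalyticBridge C D P`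
(`ArchCFockAnalytic.lean`) asks, beyond pv12-g2's Fock layer, for ℂ-LINEARITY of `Φ ↦ 𝒯_χ(Φ)` (`TΦc_add`,
`TΦc_smul`), point-continuity (`cont`), a DENSE family of standard vectors (`dense`), torus compatibility (`omg_ins`),
global invariance (`invariance`, node N21) and the two one-parameter differentiability clauses (`hF`, `hH`).  These
cannot be witnessed on the Prior one-point smoke `SmokeS4.core` (there `SK = Unit` and `𝒯_() = id`: additivity over
the zero module would force `𝒯 = 𝒯 + 𝒯`, i.e. `𝒯 = 0`).  This file exhibits an inhabitant over the smallest
LINEAR toy instead: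

* §1 `AnalyticSmoke.core / torus / pointed` — H = HG = CG = SK = ℂ, G = Unit, one isotypic index; `R = 1`,
  `ω = id`, **`𝒯_Φ = Φ • id`** (linear in Φ and non-zero), `ϑ_χ(Φ) = Φ`, `E^χ_f = 1`, `S₁₂ = ⊤`, `P_w = id`,
  point evaluation `= id`.  Every `IsolationCore` / `TorusData` / `PointedCore` field is PROVED for these data.
* §2 `AnalyticSmoke.bridgeOf` — GENERIC in the Fock layer: for ANY `pl : Fock.FockPlaces` and any linear functional
  `ℓ : pl.F →ₗ[ℂ] ℂ` with `ℓ φ⁰ ≠ 0`, killing every ladder operator (`ℓ ∘ X_k = 0`), invariant under the torus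
  (`ℓ ∘ ω_T(t) = ℓ`) and with trivial joint vacuum character (`χ(t) = 1`), the record is inhabited with
  `ins f := ℓ`, the real directions := the ladder slots themselves (`ιR := pl.ιX`, `XR := pl.X`, so `ladder_span` is
  `subset_span`), trivial one-parameter subgroups, `Y = 0`, `Sm i = univ`.  The analytic clauses then hold because the
  orbit maps are constant and `ℓ` kills `X_k φ` (so both sides of `hF` are the zero derivative) — honest scope: this
  certifies JOINT SATISFIABILITY and typing coherence of the field list, not any analytic content of [PerL] §3.3.
* §3 `AnalyticSmoke.Line` — the minimal instance: one real place whose κ-part is the line `ℂ` with `φ⁰ = 1`, the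
  EMPTY ladder family and the trivial torus; `ℓ = ` the product functional `⨂ₜ m ↦ ∏ m`.  Read-backs: `φ⁰ ≠ 0`,
  `𝒯_1 1 = 1 ≠ 0`, `bridge.toArchCDatum` elaborates, and `FockAnalyticBridge.H_occ` fires on a non-vacuous premise.
* §4 `AnalyticSmoke.Mixed` — the instance with the GENUINE raising operator: one place of mixed sign type carrying
  pv12-g2's intended local model `LocalFock.ofM` (κ-part `ℂ[P] ⊂ ℂ[z,w]`, infinite-dimensional, `φ⁰ = 1`, ladder
  family `c_b·(P·_)`, `c_b ≠ 0`, so `gen` is pv12's kernel theorem `isGeneratedBy_M`); `ℓ` = the constant coefficient,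
  which sees `φ⁰` and kills the raising operator (`P` has no constant term), while `X φ⁰ = c_b·P ≠ 0`
  (`Mixed.X_φ₀_ne_zero`, via pv12's `coeff_bal_P_pow`): the clause `hF` is exercised against a NON-ZERO ladder
  operator jointly with a non-trivial `gen`.

No placeholder proof, no `axiom`; Lean core + Mathlib + `Pv12g3.ArchCFockAnalytic` (hence pv12-g2 `ArchCFock`, pv05-g2
`ArchCAnalytic`, the landed `ArchC` / Prior `Perl34`).
-/

noncomputable section

open scoped TensorProduct

namespace HodgeCM
namespace PerL34
namespace ArchC
namespace AnalyticSmoke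

open HodgeCM.Prior.Perl34File HodgeCM.Prior.Perl34File.Perl34

local notation "⟪" x ", " y "⟫" => @inner ℂ _ _ x y

/-! ## §1 The linear one-dimensional theta toy -/

/-- The toy isolation core: H = HG = CG = SK = ℂ, G = Unit, SigIdx = SigIdxG = Unit; `R = 1`, `ω = id`,
`𝒯_Φ := Φ • id` (ℂ-linear in Φ, `𝒯_1 = id ≠ 0`), `inclCG = id`, `σ̂ = τ̂ = ⊤`, `e_σ̂ = id`. -/
def core : IsolationCore ℂ ℂ ℂ Unit ℂ Unit Unit where
  R := 1
  R_unitary := fun _ _ _ => rfl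
  omg := fun _ s => s
  TΦc := fun Φ => Φ • ContinuousLinearMap.id ℂ ℂ
  inclCG := ContinuousLinearMap.id ℂ ℂ
  hatσ := fun _ => ⊤
  hatσ_closed := by
    intro i
    rw [Submodule.top_coe]
    exact isClosed_univ
  hatσ_invariant := fun _ _ v _ => Submodule.mem_top
  hatσ_ortho := fun i j hij => absurd rfl hij
  hatσ_complete := by
    have h : (⨆ _ : Unit, (⊤ : Submodule ℂ ℂ)) = ⊤ := by simp
    rw [h]
    exact le_antisymm le_top (Submodule.le_topologicalClosure ⊤)
  eσ := fun _ => ContinuousLinearMap.id ℂ ℂ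
  eσ_mem := fun _ _ => Submodule.mem_top
  eσ_fix := fun _ _ _ => rfl
  eσ_selfAdjoint := fun _ _ _ => rfl
  AX9_espectral := fun _ _ _ _ v hv => hv
  hatτ := fun _ => ⊤
  hatτ_closed := by
    intro j
    rw [Submodule.top_coe]
    exact isClosed_univ
  hatτ_complete := by
    have h : (⨆ _ : Unit, (⊤ : Submodule ℂ ℂ)) = ⊤ := by simp
    rw [h]
    exact le_antisymm le_top (Submodule.le_topologicalClosure ⊤)

/-- (Ported verbatim from the HodgeCMPerL package; no docstring in the source.) -/
theorem TΦc_apply (Φ v : ℂ) : core.TΦc Φ v = Φ * v := rfl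

/-- (Ported verbatim from the HodgeCMPerL package; no docstring in the source.) -/
theorem TΦ_apply (Φ v : ℂ) : core.TΦ Φ v = Φ * v := rfl

/-- (Ported verbatim from the HodgeCMPerL package; no docstring in the source.) -/
theorem R_apply (h : Unit) (v : ℂ) : core.R h v = v := rfl

/-- (Ported verbatim from the HodgeCMPerL package; no docstring in the source.) -/
theorem omg_apply (h : Unit) (Φ : ℂ) : core.omg h Φ = Φ := rfl

/-- The toy torus side over `core`: X = TestFn = Unit, allowed ≡ True, `ϑ_χ(Φ) = Φ` (linear, continuous),
`E^χ_f = 1`, `S₁₂ = ⊤`, `P_w = id`, `wOccurs ≡ True`; both unfolding identities hold because `𝒯_Φ(1) = Φ`. -/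
def torus : TorusData core where
  X := Unit
  TestFn := Unit
  allowed := fun _ => True
  ϑc := fun _ Φ => Φ
  E := fun _ _ => 1
  S12 := ⊤
  S12_def := by
    symm
    apply SmokeS4.closure_span_eq_top_of_one_mem
    exact ⟨(), trivial, 1, rfl⟩
  wOccurs := fun _ => True
  Pw := ContinuousLinearMap.id ℂ ℂ
  Pw_idem := ContinuousLinearMap.id_comp _
  Pw_selfAdjoint := fun _ _ => rfl
  AX5b_ϑ_cont := fun _ => continuous_id
  AX12_transl_cont := fun _ _ => continuous_const
  ETransl := fun _ _ f => f
  AX12_E_transl := fun _ _ _ => rfl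
  AX12_unfold_lift := fun Φ _ _ =>
    Submodule.le_topologicalClosure _ (Submodule.subset_span ⟨(), (mul_one Φ).symm⟩)
  AX12_molly := fun _ Φ => subset_closure ⟨(), mul_one Φ⟩
  AX8_annihilation := by
    intro v hv
    have h := hv () ()
    rw [RCLike.inner_apply, map_one, mul_one] at h
    exact h
  AX9_w_vector := fun M _ _ i _ hne => by
    obtain ⟨v, hv, hv0⟩ := (Submodule.ne_bot_iff _).mp hne
    exact ⟨v, hv, hv0, rfl⟩

/-- The toy point structure: one point, evaluation `= id` (separating). -/
def pointed : C4a.PointedCore core where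
  Pt := Unit
  evalPt := fun _ => ContinuousLinearMap.id ℂ ℂ
  evalPt_sep := fun _ h => h ()

/-- (Ported verbatim from the HodgeCMPerL package; no docstring in the source.) -/
theorem pointFunctional_apply (Φ : ℂ) (p : Unit) (v : ℂ) : C4a.pointFunctional core pointed Φ p v = Φ * v := rfl

/-- (Ported verbatim from the HodgeCMPerL package; no docstring in the source.) -/
theorem pointFunctional_zero (p : Unit) : C4a.pointFunctional core pointed 0 p = 0 :=
  ContinuousLinearMap.ext fun v => by rw [pointFunctional_apply, zero_mul]; rfl

/-- Non-vacuity of the toy: `𝒯_1 1 = 1 ≠ 0`. -/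
theorem TΦ_one_one : core.TΦ 1 1 = 1 := by rw [TΦ_apply, mul_one]

/-! ## §2 Generic inhabitation of the S4 record from a Fock layer with a ladder-killing vacuum functional -/

/-- **The S4 record is inhabited** over the linear toy, for ANY Fock layer `pl` carrying a linear functional `ℓ` with
`ℓ φ⁰ ≠ 0`, `ℓ ∘ X_k = 0` for every ladder slot, `ℓ ∘ ω_T(t) = ℓ` and trivial joint vacuum character.  Data:
`ιT = 1`, `w = 1`, `ins f := ℓ`, `ιR := pl.ιX`, `XR := pl.X` (so `ladder_span` is tautological), `e = 1`, `Y = 0`,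
`Sm i = univ`.  Every field PROVED. -/
def bridgeOf (pl : Fock.FockPlaces) (ℓ : pl.F →ₗ[ℂ] ℂ) (hφ : ℓ pl.φ₀ ≠ 0)
    (hX : ∀ (k : pl.ιX) (φ : pl.F), ℓ (pl.X k φ) = 0)
    (hω : ∀ (t : pl.Tg) (φ : pl.F), ℓ (pl.ωT t φ) = ℓ φ)
    (hχ : ∀ t : pl.Tg, pl.χ t = 1) : FockAnalyticBridge core torus pointed where
  pl := pl
  ιT := 1
  w := 1
  w_norm := fun t => by rw [MonoidHom.one_apply, norm_one]
  w_loc := fun t => by rw [MonoidHom.one_apply, inv_one]; exact hχ t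
  TΦc_add := fun Φ Ψ => add_smul Φ Ψ (ContinuousLinearMap.id ℂ ℂ)
  TΦc_smul := fun c Φ => mul_smul c Φ (ContinuousLinearMap.id ℂ ℂ)
  cont := fun p v => by
    show Continuous fun Φ : ℂ => Φ * v
    exact continuous_id.mul continuous_const
  FinIdx := Unit
  ins := fun _ => ℓ
  dense := by
    have hmem : ℓ pl.φ₀ ∈ Submodule.span ℂ (Set.range fun q : Unit × pl.F => (fun _ : Unit => ℓ) q.1 q.2) :=
      Submodule.subset_span ⟨((), pl.φ₀), rfl⟩
    have htop : Submodule.span ℂ (Set.range fun q : Unit × pl.F => (fun _ : Unit => ℓ) q.1 q.2) = ⊤ := by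
      rw [Submodule.eq_top_iff']
      intro z
      have hz := Submodule.smul_mem _ (z / ℓ pl.φ₀) hmem
      rwa [smul_eq_mul, div_mul_cancel₀ z hφ] at hz
    rw [htop, Submodule.top_coe]
    exact dense_univ
  omg_ins := fun _ t φ => by
    show ℓ φ = ℓ (pl.ωT t φ)
    rw [hω]
  invariance := fun _ _ _ => rfl
  ιR := pl.ιX
  XR := pl.X
  e := fun _ _ => ()
  he := fun _ => rfl
  ladder_span := fun k => Submodule.subset_span ⟨k, rfl⟩
  hF := fun j f φ p => by
    show HasDerivAt (fun _ : ℝ => C4a.pointFunctional core pointed (ℓ φ) p)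
      (C4a.pointFunctional core pointed (ℓ (pl.X j φ)) p) 0
    rw [hX, pointFunctional_zero]
    exact hasDerivAt_const 0 _
  Sm := fun _ => Set.univ
  Sm_sub := fun _ _ _ => Submodule.mem_top
  Sm_dense := fun _ v _ => subset_closure (Set.mem_univ v)
  YR := fun _ _ => 0
  YR_mem := fun _ _ _ _ => Set.mem_univ _
  hH := fun j i v _ => by
    show HasDerivAt (fun _ : ℝ => v) (0 : ℂ) 0
    exact hasDerivAt_const 0 v
  wOccurs_of_eigenvector := fun _ _ => trivial

/-- Read-back: the produced `ArchCDatum`'s Fock space is `pl.F` and its spanning family is indexed by the slots. -/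
theorem bridgeOf_toArchCDatum_F (pl : Fock.FockPlaces) (ℓ : pl.F →ₗ[ℂ] ℂ) (hφ : ℓ pl.φ₀ ≠ 0)
    (hX : ∀ (k : pl.ιX) (φ : pl.F), ℓ (pl.X k φ) = 0)
    (hω : ∀ (t : pl.Tg) (φ : pl.F), ℓ (pl.ωT t φ) = ℓ φ) (hχ : ∀ t : pl.Tg, pl.χ t = 1) :
    (bridgeOf pl ℓ hφ hX hω hχ).toArchCDatum.F = pl.F ∧ (bridgeOf pl ℓ hφ hX hω hχ).toArchCDatum.ιX = pl.ιX :=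
  ⟨rfl, rfl⟩

/-- … and N29's conclusion fires on the NON-VACUOUS premise `𝒯_1 1 = 1 ≠ 0`. -/
theorem bridgeOf_H_occ (pl : Fock.FockPlaces) (ℓ : pl.F →ₗ[ℂ] ℂ) (hφ : ℓ pl.φ₀ ≠ 0)
    (hX : ∀ (k : pl.ιX) (φ : pl.F), ℓ (pl.X k φ) = 0)
    (hω : ∀ (t : pl.Tg) (φ : pl.F), ℓ (pl.ωT t φ) = ℓ φ) (hχ : ∀ t : pl.Tg, pl.χ t = 1) :
    torus.wOccurs () :=
  (bridgeOf pl ℓ hφ hX hω hχ).H_occ 1 () ⟨1, Submodule.mem_top, by rw [TΦ_one_one]; exact one_ne_zero⟩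

/-! ## §3 The instance: one real place whose κ-part is a line -/

namespace Line

/-- One real place: κ-part the line `ℂ`, `φ⁰ = 1`, EMPTY ladder family, trivial torus acting by `id` with vacuum
character `1`.  `gen`: a submodule of `ℂ` containing `1` is everything; `eigen`: `id 1 = 1 • 1`. -/
def loc : Fock.LocalFock where
  M := ℂ
  ι := Empty
  X := Empty.elim
  φ := 1
  T := Unit
  ω := fun _ => LinearMap.id
  χ := fun _ => 1
  gen := fun S h1 _ => by
    rw [Submodule.eq_top_iff']
    intro z
    simpa using S.smul_mem z h1
  eigen := fun _ => by rw [LinearMap.id_apply, one_smul]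

/-- The one-place Fock layer. -/
def places : Fock.FockPlaces where
  RP := Unit
  loc := fun _ => loc

/-- The vacuum functional `⨂ₜ m ↦ ∏_b m b` on `places.F = ⨂[ℂ] (_ : Unit), ℂ`. -/
def ell : places.F →ₗ[ℂ] ℂ :=
  PiTensorProduct.lift (MultilinearMap.mkPiAlgebra ℂ Unit ℂ)

/-- (Ported verbatim from the HodgeCMPerL package; no docstring in the source.) -/
theorem ell_tprod (m : Unit → ℂ) : ell (PiTensorProduct.tprod ℂ m) = ∏ b, m b := by
  rw [ell, PiTensorProduct.lift.tprod]
  exact MultilinearMap.mkPiAlgebra_apply m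

/-- (Ported verbatim from the HodgeCMPerL package; no docstring in the source.) -/
theorem ell_φ₀ : ell places.φ₀ = 1 := by
  show ell (PiTensorProduct.tprod ℂ fun _ : Unit => (1 : ℂ)) = 1
  rw [ell_tprod, Finset.prod_const_one]

/-- (Ported verbatim from the HodgeCMPerL package; no docstring in the source.) -/
theorem φ₀_ne_zero : places.φ₀ ≠ 0 := by
  intro h
  have h1 := ell_φ₀
  rw [h, map_zero] at h1
  exact zero_ne_one h1

/-- No ladder slots (the local index type is `Empty`). -/
theorem ell_X (k : places.ιX) (φ : places.F) : ell (places.X k φ) = 0 :=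
  (k.2 : Empty).elim

/-- (Ported verbatim from the HodgeCMPerL package; no docstring in the source.) -/
theorem ωT_eq_id (t : places.Tg) : places.ωT t = LinearMap.id :=
  PiTensorProduct.map_id

/-- (Ported verbatim from the HodgeCMPerL package; no docstring in the source.) -/
theorem ell_ωT (t : places.Tg) (φ : places.F) : ell (places.ωT t φ) = ell φ := by
  rw [ωT_eq_id, LinearMap.id_apply]

/-- (Ported verbatim from the HodgeCMPerL package; no docstring in the source.) -/
theorem χ_eq_one (t : places.Tg) : places.χ t = 1 :=
  Fintype.prod_eq_one _ fun _ => rfl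

/-- **The inhabitant.** -/
def bridge : FockAnalyticBridge core torus pointed :=
  bridgeOf places ell (by rw [ell_φ₀]; exact one_ne_zero) ell_X ell_ωT χ_eq_one

/-- (Ported verbatim from the HodgeCMPerL package; no docstring in the source.) -/
theorem nonempty_bridge : Nonempty (FockAnalyticBridge core torus pointed) := ⟨bridge⟩

example : bridge.toArchCDatum.F = places.F := rfl

example : bridge.toArchCDatum.φ₀ = places.φ₀ := rfl

/-- N29 fires through the bridge on the non-vacuous premise `𝒯_1 1 ≠ 0`. -/
theorem H_occ_fires : torus.wOccurs () :=
  bridge.H_occ 1 () ⟨1, Submodule.mem_top, by rw [TΦ_one_one]; exact one_ne_zero⟩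

end Line

/-! ## §4 The instance with the GENUINE raising operator: one mixed-sign place, κ-part `ℂ[P]`

Here the Fock layer is pv12-g2's intended local model `LocalFock.ofM` at a place of mixed sign type (tex ll. 501–505):
κ-part `kappaPartM = ℂ[P] ⊂ ℂ[z, w]` (pv12, infinite-dimensional), `φ⁰ = 1`, ladder family = the raising operator
`c_b·(P·_)` with `c_b ≠ 0` (so `gen` is pv12's KERNEL theorem `isGeneratedBy_M`: `ℂ[P] = U(𝔭′₊)·1`), trivial torus.
The vacuum functional `ℓ` = constant coefficient SEES `φ⁰` (`ℓ 1 = 1`) and KILLS the raising operator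
(`coeff₀ (c_b·P·q) = 0` since `P = Σ z_a w_a` has no constant term), while the raising operator itself is NON-ZERO on
`φ⁰` (`X φ⁰ = c_b·P`, detected by the `z₀w₀`-coefficient, pv12 `coeff_bal_P_pow`).  So the analytic clause `hF` of the
record is exercised against a non-zero ladder operator on an infinite-dimensional κ-part, jointly with `gen`,
`dense`, linearity and `invariance` — all PROVED for these data. -/

namespace Mixed

open HodgeCM.PerL34.Fock

/-- The raising operator `c_b·(P·_)` on `ℂ[P]` (tex ll. 503–504; same term as pv12-g2 `Fock.Toy.raise`). -/
def raise (cb : ℂ) : Unit → ↥kappaPartM →ₗ[ℂ] ↥kappaPartM :=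
  fun _ => cb • (LinearMap.mulLeft ℂ P).restrict fun _ hf => P_mul_mem_kappaPartM hf

/-- (Ported verbatim from the HodgeCMPerL package; no docstring in the source.) -/
theorem raise_apply (cb : ℂ) (u : Unit) (φ : ↥kappaPartM) :
    ((raise cb u φ : ↥kappaPartM) : MixedModel) = cb • (P * φ) := rfl

variable (cb : ℂ) (hcb : cb ≠ 0)

/-- One real place of mixed sign type: pv12-g2 `LocalFock.ofM` with the raising operator, T_b = Unit acting through
`AlgHom.id` with vacuum character `1`. -/
def loc : Fock.LocalFock :=
  LocalFock.ofM (raise cb) cb hcb () (raise_apply cb ()) Unit (fun _ => 1) (fun _ => AlgHom.id ℂ MixedModel)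
    fun _ _ hf => hf

/-- The one-place Fock layer `𝓕^κ = ⨂[ℂ] (_ : Unit), ℂ[P]`. -/
def places : Fock.FockPlaces where
  RP := Unit
  loc := fun _ => loc cb hcb

/-- Its ladder family GENERATES the κ-part from φ⁰ — pv12's kernel theorem `isGeneratedBy_M` through pv12-g2's
`FockPlaces.isGeneratedBy` (recorded to stress that `gen` is non-trivial here: `ℂ[P]` is not finite-dimensional). -/
theorem isGeneratedBy : IsGeneratedBy (places cb hcb).X (places cb hcb).φ₀ :=
  (places cb hcb).isGeneratedBy

/-- `⊗_b ℓ₀` for a local functional `ℓ₀` on `ℂ[P]` (one slot). -/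
def prodFn (ℓ₀ : ↥kappaPartM →ₗ[ℂ] ℂ) : (places cb hcb).F →ₗ[ℂ] ℂ :=
  PiTensorProduct.lift ((MultilinearMap.mkPiAlgebra ℂ Unit ℂ).compLinearMap fun _ => ℓ₀)

/-- (Ported verbatim from the HodgeCMPerL package; no docstring in the source.) -/
theorem prodFn_tprod (ℓ₀ : ↥kappaPartM →ₗ[ℂ] ℂ) (m : Unit → ↥kappaPartM) :
    prodFn cb hcb ℓ₀ (PiTensorProduct.tprod ℂ m) = ∏ b, ℓ₀ (m b) := by
  rw [prodFn, PiTensorProduct.lift.tprod]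
  exact (MultilinearMap.compLinearMap_apply _ _ m).trans (MultilinearMap.mkPiAlgebra_apply _)

/-- The local vacuum functional: the constant coefficient on `ℂ[P] ⊂ ℂ[z, w]`. -/
def ellM : ↥kappaPartM →ₗ[ℂ] ℂ := (MvPolynomial.lcoeff ℂ 0).comp kappaPartM.subtype

/-- (Ported verbatim from the HodgeCMPerL package; no docstring in the source.) -/
theorem ellM_apply (φ : ↥kappaPartM) : ellM φ = MvPolynomial.coeff 0 (φ : MixedModel) := rfl

/-- (Ported verbatim from the HodgeCMPerL package; no docstring in the source.) -/
theorem ellM_one : ellM ⟨1, one_mem_kappaPartM⟩ = 1 := by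
  rw [ellM_apply, MvPolynomial.coeff_zero_one]

/-- `P = Σ_a z_a w_a` has no constant term. -/
theorem constantCoeff_P : MvPolynomial.constantCoeff P = 0 := by
  simp [P, mz, mw, MvPolynomial.constantCoeff_X]

/-- (Ported verbatim from the HodgeCMPerL package; no docstring in the source.) -/
theorem coeff_zero_P_mul (q : MixedModel) : MvPolynomial.coeff 0 (P * q) = 0 := by
  show MvPolynomial.constantCoeff (P * q) = 0
  rw [map_mul, constantCoeff_P, zero_mul]

/-- The vacuum functional KILLS the raising operator. -/
theorem ellM_raise (u : Unit) (φ : ↥kappaPartM) : ellM (raise cb u φ) = 0 := by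
  rw [ellM_apply, raise_apply, MvPolynomial.coeff_smul, coeff_zero_P_mul, smul_zero]


-- port_pkg: scope closed for this part
end Mixed
end AnalyticSmoke
end ArchC
end PerL34
end HodgeCM
end
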